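import Mathlib
import HarnessLib
import Summits.ValiantsHypothesis.ValiantsHypothesis.Theses.MonotoneRestoration
import Literature.Computability.AlgebraicComplexity.ArithCircuit
import Literature.Computability.AlgebraicComplexity.ArithCircuitProofs
import Literature.Computability.AlgebraicComplexity.MonotoneStructure
import Literature.Computability.AlgebraicComplexity.PermanentIrreducible
import Literature.ModelTheory.FiniteModelTheory.CkEquiv
import Summits.ValiantsHypothesis.ValiantsHypothesis.Theorems.MonotoneRestorationMonotoneRestorationQPCosetCount
import Summits.ValiantsHypothesis.ValiantsHypothesis.Theorems.MonotoneRestorationMonotoneRestorationQPSymmetricLB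
import Summits.ValiantsHypothesis.ValiantsHypothesis.Theorems.MonotoneRestorationMonotoneRestorationQPSupportSymmetrisation
import Summits.ValiantsHypothesis.ValiantsHypothesis.Theorems.MonotoneRestorationMonotoneRestorationQPSparseRegime
import Summits.ValiantsHypothesis.ValiantsHypothesis.Theorems.MonotoneRestorationMonotoneRestorationQPBeta
import Literature.Computability.AlgebraicComplexity.SymmetricArithCircuit
import Literature.Computability.AlgebraicComplexity.DawarWilsenach2025Proofs
import Literature.GroupTheory.PermutationGroups.SmallIndexSubgroups
import Summits.ValiantsHypothesis.ValiantsHypothesis.Theorems.MonotoneRestorationQP.Negative.LoadBearing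
import Summits.ValiantsHypothesis.ValiantsHypothesis.Theorems.MonotoneRestorationMonotoneRestorationQPPermSupportCount

/-! TTRL-lite variant V18941 of stmt-ValiantsHypothesis-15886 -/

-- `ValiantsHypothesis.ValiantsHypothesis`: the D-0017 layout repeats the problem name in the path.
set_option linter.dupNamespace false

namespace Summit.ValiantsHypothesis.ValiantsHypothesis.Theorems

open Summit.ValiantsHypothesis.ValiantsHypothesis.Theses.MonotoneRestoration
open Literature.Computability.AlgebraicComplexity

/-- **Extension relation as a support inclusion** (TTRL-lite variant V18941 of
`stub_mulGate_children_extend`). For `p f : MvPolynomial _ ℝ≥0` and an exponent vector `μ`,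
"every monomial of `p` shifted by `μ` is a monomial of `f`" is the same as
`(p * X^μ).support ⊆ f.support`, because the support of `p * monomial μ 1` is exactly the
`μ`-translate of the support of `p` (`coeff (m + μ) (p * monomial μ 1) = coeff m p`, and
`coeff m' (p * monomial μ 1) = 0` unless `μ ≤ m'`). This turns the extension hypothesis `hext`
into divisibility-style algebra, composable under products. [folklore] -/
theorem stub_mulGate_children_extend_var18941 :
    ∀ (n : ℕ) (p f : MvPolynomial (Fin n × Fin n) NNReal) (μ : (Fin n × Fin n) →₀ ℕ),
      (∀ m ∈ p.support, m + μ ∈ f.support) ↔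
        (p * MvPolynomial.monomial μ 1).support ⊆ f.support := by
  intro n p f μ
  constructor
  · intro h m' hm'
    rw [MvPolynomial.mem_support_iff, MvPolynomial.coeff_mul_monomial'] at hm'
    split_ifs at hm' with hle
    · rw [mul_one] at hm'
      have key := h (m' - μ) (MvPolynomial.mem_support_iff.mpr hm')
      rwa [tsub_add_cancel_of_le hle] at key
    · exact absurd rfl hm'
  · intro h m hm
    apply h
    rw [MvPolynomial.mem_support_iff, MvPolynomial.coeff_mul_monomial, mul_one]
    exact MvPolynomial.mem_support_iff.mp hm

end Summit.ValiantsHypothesis.ValiantsHypothesis.Theorems
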